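import Literature.AnabelianGeometry.SemiGraphs.PSCVertexStabilizerCharacterizationProofs
import Literature.AnabelianGeometry.SemiGraphs.PSCRamificationProofs
import HarnessLib

/-!
# [CombGC] Thm. 1.6 (iii) necessity over covering data: the origin-feedable form

Companion of `PSCVertexStabilizerCharacterizationProofs` (abc-iut cell, row CombGC:Thm1.6(iii)/T16-L16).
That file discharges the level-wise binder `hVC` of `PSCUnrVerticialNecessityProofs` from abc-iut-w4-d052's
typed [IUTchI] Rmk. 1.2.3 (iv) predicates of the covering data `G.restrict U hU` in their STURDY-GUARDED
form (`IsSturdy (G.restrict U hU) → …`, `UnrVertAbOfRank`), which go through the covering datum's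
GENUS — a "class (ii)" field in abc-iut-L3-t4's terminology (finding 2026-08-26T03:44:15Z: faithful to
the geometric covering only through the branch-data repair `restrictBD`).  Following abc-iut-L5-t6's
remark (STATUS 04:51:25Z), this file restates the discharge with the STURDY-FREE BODIES of those
predicates as inputs — statements about `vertexQuotientKer`, `unrVertAb`, `IsElemAbUnrQuotient`,
`IsVerticiallyPurelyTotallyRamified` of the covering datum only ("class (i)", shared definitionally by
`restrict` and `restrictBD`), so that the origin statements about the repaired data feed it with no
transport:

* `vertexStabilizer_iff_of_bodies`, `vertexStabilizerCharacterization_levels_of_bodies` — the binder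
  `hVC` from, per level `U`: (VQ) the body of `VertexQuotientCharacterization`, (VS) the body of
  `VertexSetCharacterization`, (EX) the existence of the quotients `φ_w`
  (`exists_isElemAbUnrQuotient_inf_eq_vertexQuotientKer`'s conclusion);
* `unrVerticiallyFiltrationPreservingIffVerticial_of_bodies` — [CombGC] Thm. 1.6 (iii) for `(G, H, β)`
  (typed row predicate) from: `AbelianizedGrphRank` (Rmk. 1.1.3), the typed connectivity bound
  `VertCountLeNodeCountSucc` (`i ≤ n + 1`, GAP-LEDGER G-w5d174-3) and (VQ)(VS)(EX) for the covering data of `G` and `H` — [CombGC] Rmk. 1.4.2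
  needs NO hypothesis: abc-iut-L3's `verticialPureRamificationCount` proves it for every datum
  (observation of abc-iut-w4-d016, 04:52:16Z).

0 defs; nothing here takes a side on [IUTchIII] Cor. 3.12. [cite: Mochizuki2012, IUTchI Rmk 1.2.3(iv) p.42]
[cite: MochizukiCombGC2007, Thm 1.6(iii) p.14]
-/

noncomputable section

namespace Literature.AnabelianGeometry.SemiGraphs

namespace PSCDatum

open scoped Pointwise
open PSCCovering

universe u

variable {P : Type u} [Group P] [TopologicalSpace P] [IsTopologicalGroup P] [CompactSpace P]
  [T2Space P]

/-! ### 1. The vertex-stabilizer characterization at a level, from the sturdy-free bodies -/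

section Level

variable (G : PSCDatum P) (U : Subgroup P) [U.FiniteIndex] (hU : IsOpen (U : Set P))

omit [CompactSpace P] [T2Space P] in
/-- **[IUTchI] Rmk. 1.2.3 (iv) for the covering `G_U`, read on stabilizers — from the sturdy-free bodies**:
granted for the datum `G_U` and the prime `l` (VQ) the characterization of the vertex quotients as the
maximal verticially-purely-totally-ramified elementary abelian quotients, (VS) "[nontrivial!]" and the
injectivity of `w ↦ Ker_w`, (EX) the existence of the quotients `φ_w`, a subgroup `S` of `Π_G` is a vertex
stabilizer `U · Π_v^γ` of `G_U` iff it is the normalizer of `vertFil U ∩ H'` for a maximal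
verticially-purely-totally-ramified kernel `H' ⊊ U`. [cite: Mochizuki2012, IUTchI Rmk 1.2.3(iv) p.42] -/
theorem vertexStabilizer_iff_of_bodies (hUn : U.Normal) (hKU : G.unrKer ≤ U) {l : ℕ}
    (hVQ : ∀ H₁ : Subgroup U, (G.restrict U hU).IsElemAbUnrQuotient l H₁ →
      ((∃ w : (G.restrictGraph U).V, (G.restrict U hU).unrVertAb ⊔ H₁ = ⊤ ∧
          (G.restrict U hU).unrVertAb ⊓ H₁ = (G.restrict U hU).vertexQuotientKer l w) ↔
        ((G.restrict U hU).IsVerticiallyPurelyTotallyRamified ⊤ H₁ ∧ ∀ H₂ : Subgroup U,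
          (G.restrict U hU).IsElemAbUnrQuotient l H₂ →
          (G.restrict U hU).IsVerticiallyPurelyTotallyRamified ⊤ H₂ → H₂ ≤ H₁ → H₂ = H₁)))
    (hVS : Function.Injective ((G.restrict U hU).vertexQuotientKer l) ∧
      ∀ w : (G.restrictGraph U).V, (G.restrict U hU).vertexQuotientKer l w ≠ (G.restrict U hU).unrVertAb)
    (hEX : ∀ w : (G.restrictGraph U).V, ∃ H₁ : Subgroup U, (G.restrict U hU).IsElemAbUnrQuotient l H₁ ∧
      (G.restrict U hU).unrVertAb ⊔ H₁ = ⊤ ∧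
      (G.restrict U hU).unrVertAb ⊓ H₁ = (G.restrict U hU).vertexQuotientKer l w)
    (S : Subgroup P) :
    (∃ (v : G.graph.V) (γ : ConjAct P), S = U ⊔ γ • G.vertGp v) ↔
      ∃ H' : Subgroup P,
        (H' ≤ U ∧ H' ≠ U ∧ IsOpen (H' : Set P) ∧ (⁅U, U⁆ ⊔ G.unrKer).topologicalClosure ≤ H' ∧
          ∀ u ∈ U, u ^ l ∈ H') ∧
        (G.IsVerticiallyPurelyTotallyRamified U H' ∧ ∀ H'' : Subgroup P,
          (H'' ≤ U ∧ H'' ≠ U ∧ IsOpen (H'' : Set P) ∧ (⁅U, U⁆ ⊔ G.unrKer).topologicalClosure ≤ H'' ∧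
            ∀ u ∈ U, u ^ l ∈ H'') →
          G.IsVerticiallyPurelyTotallyRamified U H'' → H'' ≤ H' → H'' = H') ∧
        S = Subgroup.normalizer ((G.vertFil U ⊓ H' : Subgroup P) : Set P) := by
  obtain ⟨hinj, hnontriv⟩ := hVS
  have hback : ∀ V : Subgroup U, (V.map U.subtype).subgroupOf U = V :=
    fun V => Subgroup.comap_map_eq_self_of_injective U.subtype_injective V
  constructor
  · rintro ⟨v, γ, hS⟩
    set j := dcIdx U (G.vertGp v) (ConjAct.ofConjAct γ) with hj
    have hne : Nonempty (G.restrictGraph U).V := ⟨⟨v, j⟩⟩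
    obtain ⟨H₁, hq, hsup, hinf⟩ := hEX ⟨v, j⟩
    obtain ⟨hvD, hmaxD⟩ := (hVQ H₁ hq).mp ⟨⟨v, j⟩, hsup, hinf⟩
    have hle : H₁.map U.subtype ≤ U := Subgroup.map_subtype_le H₁
    have hne' : H₁.map U.subtype ≠ U := by
      intro hEq
      apply hnontriv ⟨v, j⟩
      rw [← hinf, ← hback H₁, hEq, Subgroup.subgroupOf_self, inf_top_eq]
    refine ⟨H₁.map U.subtype, (G.elemAbKernel_iff_restrict U hU hKU).mpr
      ⟨hle, (hback H₁).symm ▸ hq, hne'⟩,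
      ⟨(G.isVerticiallyPurelyTotallyRamified_restrict_iff hU hle).mp ((hback H₁).symm ▸ hvD),
        (G.vptrMaximal_iff_restrict U hU hKU hle).mpr ((hback H₁).symm ▸ hmaxD)⟩, ?_⟩
    rw [hS, G.sup_smul_vertGp_eq_sup_vrep U hUn v γ, ← hj,
      ← normalizer_map_vertexQuotientKer_restrict hU hUn hKU hinj v j, ← hinf, ← hback H₁,
      G.map_subtype_unrVertAb_inf_restrict U hU hne hle, hback]
  · rintro ⟨H', hE, ⟨hV, hmax⟩, hS⟩
    have hle : H' ≤ U := hE.1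
    obtain ⟨v₀, γ₀, -⟩ := hV.2
    have hne : Nonempty (G.restrictGraph U).V := ⟨⟨v₀, dcIdx U (G.vertGp v₀) (ConjAct.ofConjAct γ₀)⟩⟩
    obtain ⟨-, hq, -⟩ := (G.elemAbKernel_iff_restrict U hU hKU).mp hE
    have hvD := (G.isVerticiallyPurelyTotallyRamified_restrict_iff hU hle).mpr hV
    have hmaxD := (G.vptrMaximal_iff_restrict U hU hKU hle).mp hmax
    obtain ⟨⟨v, j⟩, hsup, hinf⟩ := (hVQ _ hq).mpr ⟨hvD, hmaxD⟩
    refine ⟨v, ConjAct.toConjAct (G.vrep U ⟨v, j⟩), ?_⟩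
    rw [hS, ← G.map_subtype_unrVertAb_inf_restrict U hU hne hle, hinf,
      normalizer_map_vertexQuotientKer_restrict hU hUn hKU hinj v j]

end Level

/-! ### 2. The binder `hVC`, and Theorem 1.6 (iii), from the bodies -/

section Levels

variable (G : PSCDatum P)

omit [T2Space P] in
/-- **The binder `hVC` of `PSCUnrVerticialNecessityProofs` from the sturdy-free bodies (VQ), (VS), (EX)
for the covering data of all levels** (statements about class-(i) objects of the covering datum only,
hence feedable from the origin statements about abc-iut-L3-t4's repaired data `restrictBD`).
[cite: Mochizuki2012, IUTchI Rmk 1.2.3(iv) p.42] -/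
theorem vertexStabilizerCharacterization_levels_of_bodies {l₀ : ℕ} (hl₀ : G.Sigma = {l₀})
    (hVQ : ∀ (U : Subgroup P) [U.FiniteIndex] (hU : IsOpen (U : Set P)), G.unrKer ≤ U →
      ∀ H₁ : Subgroup U, (G.restrict U hU).IsElemAbUnrQuotient l₀ H₁ →
      ((∃ w : (G.restrictGraph U).V, (G.restrict U hU).unrVertAb ⊔ H₁ = ⊤ ∧
          (G.restrict U hU).unrVertAb ⊓ H₁ = (G.restrict U hU).vertexQuotientKer l₀ w) ↔
        ((G.restrict U hU).IsVerticiallyPurelyTotallyRamified ⊤ H₁ ∧ ∀ H₂ : Subgroup U,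
          (G.restrict U hU).IsElemAbUnrQuotient l₀ H₂ →
          (G.restrict U hU).IsVerticiallyPurelyTotallyRamified ⊤ H₂ → H₂ ≤ H₁ → H₂ = H₁)))
    (hVS : ∀ (U : Subgroup P) [U.FiniteIndex] (hU : IsOpen (U : Set P)), G.unrKer ≤ U →
      Function.Injective ((G.restrict U hU).vertexQuotientKer l₀) ∧
      ∀ w : (G.restrictGraph U).V,
        (G.restrict U hU).vertexQuotientKer l₀ w ≠ (G.restrict U hU).unrVertAb)
    (hEX : ∀ (U : Subgroup P) [U.FiniteIndex] (hU : IsOpen (U : Set P)), G.unrKer ≤ U →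
      ∀ w : (G.restrictGraph U).V, ∃ H₁ : Subgroup U, (G.restrict U hU).IsElemAbUnrQuotient l₀ H₁ ∧
        (G.restrict U hU).unrVertAb ⊔ H₁ = ⊤ ∧
        (G.restrict U hU).unrVertAb ⊓ H₁ = (G.restrict U hU).vertexQuotientKer l₀ w) :
    G.IsSturdy → ∀ l : ℕ, G.Sigma = {l} → ∀ U : Subgroup P, U.Normal → IsOpen (U : Set P) →
      G.unrKer ≤ U → ∀ S : Subgroup P, U ≤ S →
      ((∃ (v : G.graph.V) (γ : ConjAct P), S = U ⊔ γ • G.vertGp v) ↔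
        ∃ H' : Subgroup P,
          (H' ≤ U ∧ H' ≠ U ∧ IsOpen (H' : Set P) ∧ (⁅U, U⁆ ⊔ G.unrKer).topologicalClosure ≤ H' ∧
            ∀ u ∈ U, u ^ l ∈ H') ∧
          (G.IsVerticiallyPurelyTotallyRamified U H' ∧ ∀ H'' : Subgroup P,
            (H'' ≤ U ∧ H'' ≠ U ∧ IsOpen (H'' : Set P) ∧
                (⁅U, U⁆ ⊔ G.unrKer).topologicalClosure ≤ H'' ∧ ∀ u ∈ U, u ^ l ∈ H'') →
            G.IsVerticiallyPurelyTotallyRamified U H'' → H'' ≤ H' → H'' = H') ∧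
          S = Subgroup.normalizer ((G.vertFil U ⊓ H' : Subgroup P) : Set P)) := by
  intro _ l hl U hUn hUo hKU S _
  have hll : l = l₀ := by
    have h := hl.symm.trans hl₀
    exact Set.singleton_eq_singleton_iff.mp h
  subst hll
  haveI : DiscreteTopology (P ⧸ U) := QuotientGroup.discreteTopology hUo
  haveI : Finite (P ⧸ U) := finite_of_compact_of_discrete
  haveI : U.FiniteIndex := Subgroup.finiteIndex_of_finite_quotient
  exact G.vertexStabilizer_iff_of_bodies U hUo hUn hKU (hVQ U hUo hKU) (hVS U hUo hKU) (hEX U hUo hKU) S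

end Levels

section Thm16iii

variable {P' : Type u} [Group P'] [TopologicalSpace P'] [IsTopologicalGroup P'] [CompactSpace P']
  [T2Space P']
variable [TotallyDisconnectedSpace P] [TotallyDisconnectedSpace P']
variable (G : PSCDatum P) (H : PSCDatum P') (β : (P ⧸ G.unrKer) ≃ₜ* (P' ⧸ H.unrKer))

omit [T2Space P] [T2Space P'] in
/-- **[CombGC] Theorem 1.6 (iii) for `(G, H, β)` — the typed row predicate
`UnrVerticiallyFiltrationPreservingIffVerticial` — for profinite `Π_G`, `Π_H`, `Σ_G = Σ_H = {l}`, from:**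
[CombGC] Rmk. 1.1.3 (`AbelianizedGrphRank`, typed, abc-iut-w4-d052) for `G`, `H`; the connectivity bound
`i ≤ n + 1` for coverings (abc-iut-w4-d052's typed `VertCountLeNodeCountSucc`, statements IV; GAP-LEDGER
G-w5d174-3); and, for the covering data of every level of
`G` and of `H`, the sturdy-free bodies of [IUTchI] Rmk. 1.2.3 (iv) — (VQ) vertex quotients = maximal
verticially-purely-totally-ramified elementary abelian quotients, (VS) "[nontrivial!]" + injectivity,
(EX) existence of the `φ_w`.  ([CombGC] Rmk. 1.4.2 enters as the THEOREM `verticialPureRamificationCount`;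
sufficiency is abc-iut-L5-t6's Rmk. 1.2.3 (vii) theorem.) [cite: MochizukiCombGC2007, Thm 1.6(iii) p.13] -/
theorem unrVerticiallyFiltrationPreservingIffVerticial_of_bodies {l : ℕ} (hSG : G.Sigma = {l})
    (hSH : H.Sigma = {l}) (hrkG : G.AbelianizedGrphRank) (hrkH : H.AbelianizedGrphRank)
    (hiG : G.VertCountLeNodeCountSucc) (hiH : H.VertCountLeNodeCountSucc)
    (hVQG : ∀ (U : Subgroup P) [U.FiniteIndex] (hU : IsOpen (U : Set P)), G.unrKer ≤ U →
      ∀ H₁ : Subgroup U, (G.restrict U hU).IsElemAbUnrQuotient l H₁ →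
      ((∃ w : (G.restrictGraph U).V, (G.restrict U hU).unrVertAb ⊔ H₁ = ⊤ ∧
          (G.restrict U hU).unrVertAb ⊓ H₁ = (G.restrict U hU).vertexQuotientKer l w) ↔
        ((G.restrict U hU).IsVerticiallyPurelyTotallyRamified ⊤ H₁ ∧ ∀ H₂ : Subgroup U,
          (G.restrict U hU).IsElemAbUnrQuotient l H₂ →
          (G.restrict U hU).IsVerticiallyPurelyTotallyRamified ⊤ H₂ → H₂ ≤ H₁ → H₂ = H₁)))
    (hVSG : ∀ (U : Subgroup P) [U.FiniteIndex] (hU : IsOpen (U : Set P)), G.unrKer ≤ U →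
      Function.Injective ((G.restrict U hU).vertexQuotientKer l) ∧
      ∀ w : (G.restrictGraph U).V, (G.restrict U hU).vertexQuotientKer l w ≠ (G.restrict U hU).unrVertAb)
    (hEXG : ∀ (U : Subgroup P) [U.FiniteIndex] (hU : IsOpen (U : Set P)), G.unrKer ≤ U →
      ∀ w : (G.restrictGraph U).V, ∃ H₁ : Subgroup U, (G.restrict U hU).IsElemAbUnrQuotient l H₁ ∧
        (G.restrict U hU).unrVertAb ⊔ H₁ = ⊤ ∧
        (G.restrict U hU).unrVertAb ⊓ H₁ = (G.restrict U hU).vertexQuotientKer l w)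
    (hVQH : ∀ (U₁ : Subgroup P') [U₁.FiniteIndex] (hU₁ : IsOpen (U₁ : Set P')), H.unrKer ≤ U₁ →
      ∀ H₁ : Subgroup U₁, (H.restrict U₁ hU₁).IsElemAbUnrQuotient l H₁ →
      ((∃ w : (H.restrictGraph U₁).V, (H.restrict U₁ hU₁).unrVertAb ⊔ H₁ = ⊤ ∧
          (H.restrict U₁ hU₁).unrVertAb ⊓ H₁ = (H.restrict U₁ hU₁).vertexQuotientKer l w) ↔
        ((H.restrict U₁ hU₁).IsVerticiallyPurelyTotallyRamified ⊤ H₁ ∧ ∀ H₂ : Subgroup U₁,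
          (H.restrict U₁ hU₁).IsElemAbUnrQuotient l H₂ →
          (H.restrict U₁ hU₁).IsVerticiallyPurelyTotallyRamified ⊤ H₂ → H₂ ≤ H₁ → H₂ = H₁)))
    (hVSH : ∀ (U₁ : Subgroup P') [U₁.FiniteIndex] (hU₁ : IsOpen (U₁ : Set P')), H.unrKer ≤ U₁ →
      Function.Injective ((H.restrict U₁ hU₁).vertexQuotientKer l) ∧
      ∀ w : (H.restrictGraph U₁).V,
        (H.restrict U₁ hU₁).vertexQuotientKer l w ≠ (H.restrict U₁ hU₁).unrVertAb)
    (hEXH : ∀ (U₁ : Subgroup P') [U₁.FiniteIndex] (hU₁ : IsOpen (U₁ : Set P')), H.unrKer ≤ U₁ →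
      ∀ w : (H.restrictGraph U₁).V, ∃ H₁ : Subgroup U₁, (H.restrict U₁ hU₁).IsElemAbUnrQuotient l H₁ ∧
        (H.restrict U₁ hU₁).unrVertAb ⊔ H₁ = ⊤ ∧
        (H.restrict U₁ hU₁).unrVertAb ⊓ H₁ = (H.restrict U₁ hU₁).vertexQuotientKer l w) :
    G.UnrVerticiallyFiltrationPreservingIffVerticial H β :=
  G.unrVerticiallyFiltrationPreservingIffVerticial_of_levelwise H β hSG hSH hrkG hrkH
    (G.verticialPureRamificationCount_levels_of_restrict fun U _ hU _ =>
      (G.restrict U hU).verticialPureRamificationCount)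
    (H.verticialPureRamificationCount_levels_of_restrict fun U₁ _ hU₁ _ =>
      (H.restrict U₁ hU₁).verticialPureRamificationCount)
    (fun U hU _ => hiG U hU) (fun U₁ hU₁ _ => hiH U₁ hU₁)
    (G.vertexStabilizerCharacterization_levels_of_bodies hSG hVQG hVSG hEXG)
    (H.vertexStabilizerCharacterization_levels_of_bodies hSH hVQH hVSH hEXH)

end Thm16iii

end PSCDatum

end Literature.AnabelianGeometry.SemiGraphs

end
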